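import Literature.MathematicalPhysics.QuantumFieldTheory.Balaban1983to89.B9Thm31SiteAgmonExponentY
import Literature.MathematicalPhysics.QuantumFieldTheory.Balaban1983to89.B9Thm31SiteGsqBoundsReg335Y

/-!
# `Balaban1983to89.B9Thm31SiteGsqDecayReg335Y` — T. Bałaban, *Propagators for lattice gauge theories in a background field*, Commun. Math. Phys.
# **99** (1985) 389–434 [Balaban1985BackgroundPropagators] Cor 3.6 p. 408 ∕ Thm 3.1 (3.46) p. 398 ∕ (3.79) p. 406, by S. Agmon's positive-weight method
# [Agmon1982]: ★★★ **COROLLARY 3.6's (3.46a) IN `L²` FOR THE GENUINE LOCAL CUBE INVERSES `G′_□(U) = GsqY i (parSymY i) D U`, UNIFORMLY IN □** — files 6 ∕ 7 of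
# this seat (`B9Thm31SiteGpDecayReg335Y`, `B9Thm31SiteAgmonWeightY`) and dag-n06-j's `B9Thm31SiteAgmonExponentY` VERBATIM for every Dirichlet compression
# (file 20 of the site-sector set of width seat `pub-ymgap-dag-n06-w1`; file 19 = `B9Thm31SiteGsqBoundsReg335Y` gives the `L²` operator bounds)

statement-level skeleton of published theorems with citation tags; proofs where landed; nothing here is a claim about the Yang–Mills mass gap

THE PRINT (verbatim).  p. 408, Cor 3.6: *«the operators `G′_□`, `G_□` … satisfy the inequalities (3.42)–(3.47) with constants independent of □»*; p. 398,
(3.46): *«Finally, we have the inequalities in L²-norms ‖hG′(U)λ‖, … ≦ B₀[(Lʲη)², …]|h|e^{−δ₀d(y,y′)}‖λ‖ for supp h ⊂ Δ(y), y ∈ Λ_j, supp λ ⊂ Δ(y′)»*;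
p. 406, (3.79): `G′_□` = the propagator (3.24)–(3.25) for the sequence `{Ω_n(□)}` (the inverse of `Δ′_a(U)` on the functions on □̃).

WHY THIS FILE (cell `pub-ymgap`, Track A node N06 [B9], width seat `pub-ymgap-dag-n06-w1`, gen 3).  The N06 certificate's row 18 displays Thm 3.6 ∕ Cor 3.6 at the
LOCAL cube operators of the walk (3.87)–(3.90) (`h36`, `h36H`: `Local342`, `L2SecondLegs37`, `L2MixedLegs37`, …); the walk-letter instance W-a (node00-def-Y
FILE 35 ∕ A-1, dag-n06-d FILE C) pins those cube operators to def-Y's genuine `GsqY i parS (cubeDomY x c) U`.  The `L²` members of Cor 3.6 for `G′_□` therefore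
need (3.46)-type decay for `GsqY … D U` with constants free of `D`.  Files 6∕7 proved (3.46a) for the whole-lattice `G′(U) = GpY` (= `GsqY … univ`); THIS FILE
proves it for EVERY `D`, with the SAME constants (`B₀ = 16`, `δ₀ = 1∕(4(d+2))`), by the same two Agmon readings — the one new step being that the conjugated
form at `ω·G′_□(U)Ψ` is still the plain pairing `⟨G′_□Ψ, Ψ⟩` (`ω²G′_□Ψ` is □̃-supported, so only `P_D Δ′_a(U) G′_□(U) = P_D` — regime-free, dag-n06-j's
`isUnit_padDeltaY_parSymY` — is used, NOT a conjugated coercivity of the padded compression).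

WHAT IS PROVED (sorry-free; 0 `def`; no inequality of [B9] asserted as a hypothesis-free fact beyond what is proved).
* §1 support bookkeeping: `cubeProjY_apply_of_support` (a field vanishing off `D` is fixed by `P_D`), `wsmul_GsqY_apply_eq_zero`, `cubeProjY_apply_eq_zero_of_support`,
  `cubeProjY_deltaPrimeAY_GsqY_apply` (`P_D Δ′_a(U) G′_□(U)Ψ = P_DΨ`), `trIP_GsqY_deltaPrimeAY_GsqY` (`⟨G′_□Ψ, Δ′_a(U)G′_□Ψ⟩₁ = ⟨G′_□Ψ, Ψ⟩₁`) — regime-free, every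
  `G`-valued `U`, `G ≤ U(N)`.
* §2 Agmon's readings ON THE CLASS `(bg9K (M_N ℂ) G i).Reg335 c α₀`, `N ≥ 1`, `0 ≤ c·M·α₀`, `c·M·α₀·(d+1) ≤ 1∕16`, every `D`: ★ `conj_wsmul_GsqY_eq_pairing`,
  ★★ `levelMass_wsmul_GsqY_le_pairing`, ★★ `pairing_GsqY_le_of_support`, ★★★ `hs_restrict_GsqY_parSymY_le` (`Σ_{z∈A}HS((G′_□(U)Ψ) z) ≤ 256·((L^{j_A})²(L^{j_B})²∕W²)·‖Ψ‖²₁`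
  under file 6's weight hypotheses).
* §3 the rates: ★★ `hs_restrict_GsqY_parSymY_le_exp` (Agmon weight `e^{δρ}`), ★★★ `hs_restrict_GsqY_parSymY_le_exp_canonical` (`δ₀ = 1∕(4(d+2))`),
  ★★★ `hs_restrict_GsqY_parSymY_le_distT` (print's rate in the BLOCK distance via dag-n06-j's multi-scale exponent `msRhoT`: source block `s`, `A` at block
  distance `≥ n`: `≤ 256·((L^{j_A})²(L^{j_B})²∕(e^{δ₀(n−1)∕(2L)})²)·‖λ‖²₁`, k-uniform), `hs_restrict_GsqY_univ_eq` (the `D = univ` face is `GpY`).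
MODEL ∕ DECLARED READINGS.  As files 6∕7∕19 ((M1)–(M5)): def-Y's letters on NODE 00's box chart, fibre `M_N(ℂ)`, weight-`1` trace pairing, masses in lattice units,
□̃ = an arbitrary finite site set `D`, Dirichlet restriction = def-Y's `GsqY` BY NAME.  The `L²` (3.46a) member only; NOT the sup-norm (3.42), NOT the derivative
members (files 21+), NOT the bond sector `G_□`.  NON-VACUITY (A6): `U ≡ 1 ∈ Reg335 c α₀` (`reg335_one`); the weight hypotheses are inhabited by the canonical
weight (§3) and by `msRhoT` (dag-n06-j `B6AgmonExponentMultiLevelTorus`).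
HONEST SCOPE.  Agmon bookkeeping over landed estimates, constants explicit; NOT a node discharge, NOT summit progress; count-neutral; nothing continuum ∕ OS ∕
mass gap ∕ Clay.  NEW file importing `B9Thm31SiteAgmonExponentY` and file 19 only; everything of files 6∕7 and of dag-n06-j's exponent file consumed BY NAME
(`trIP_wsmul_deltaPrimeAY_winv_ge_levelMass`, `trIP_wsq_eq_of_support`, `abs_trIP_le_of_support`, `sum_filter_hs_le_levelMass`, `agmon_arith(_pairing)`,
`agmon_unpack`, `bondRatio_exp_le(')`, `blockOsc_exp_le`, `msRhoY_*`); nothing landed is modified.  Net new unproved facts: 0.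
-/

noncomputable section

namespace Literature.MathematicalPhysics.QuantumFieldTheory.Balaban1983to89.B9Thm31SiteGsqDecayReg335Y

open Literature.MathematicalPhysics.QuantumFieldTheory.Balaban1983to89
open Node00 B6KLevelCensusIndexV1 B6Geom246MultiLevelBox B6MultiLevelBoxOperator B6MultiLevelTorusOperator B6GlobalChartV1 B9BackgroundsKLevelV1
  B9Eq39Adjoint B9Thm311ReadingCoords B9Thm311DeltaPrimePos B9Ineq369CurvatureSmallAtLettersY B9Thm31SiteCoerciveReg335Y B9Thm31SiteGpBoundsReg335Y
  B9Thm31SiteGpDecayReg335Y B9Thm31SiteAgmonWeightY B9Thm31SiteAgmonExponentY B6Geom246MultiLevelTorus B6TorusSiteWalks B6AgmonExponentMultiLevelTorus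
  Node00.OpsYLocalInverse B9Thm311LocalInversePosY B9Thm31SiteGsqBoundsReg335Y
open Literature.MathematicalPhysics.QuantumFieldTheory.Balaban1983to89.B9Ineq349SiteAdjoint (trIP_comm)
open scoped Matrix Matrix.Norms.L2Operator

variable {d ℓ : ℕ} {hd : 1 ≤ d + 1} {hL : Odd (ℓ + 1) ∧ 1 < ℓ + 1} {b₀ b₁ : ℝ}
variable (i : KIdx d ℓ hd hL b₀ b₁) {N : ℕ} {G : Subgroup (Matrix (Fin N) (Fin N) ℂ)ˣ}

/-! ## §1 Support bookkeeping: fields vanishing off □̃ are fixed by `P_D`; `P_D Δ′_a(U) G′_□(U) = P_D` pointwise -/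

section Support

/-- a field vanishing off `D` is fixed by the cube projection. [cite: Balaban1985BackgroundPropagators, (3.79) p.406, bookkeeping] -/
theorem cubeProjY_apply_of_support {D : Finset (SiteY i)} {Φ : SiteY i → Matrix (Fin N) (Fin N) ℂ} (hΦ : ∀ z, z ∉ D → Φ z = 0) :
    cubeProjY i D Φ = Φ := by
  funext z
  rw [cubeProjY_apply]
  split_ifs with hz
  · rfl
  · exact (hΦ z hz).symm

/-- a real-weighted copy of `G′_□(U)Ψ` vanishes off □̃. [cite: Balaban1985BackgroundPropagators, (3.79) p.406, bookkeeping] -/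
theorem wsmul_GsqY_apply_eq_zero (par : SiteParY (Matrix (Fin N) (Fin N) ℂ) i) {D : Finset (SiteY i)} (U : CfgY (Matrix (Fin N) (Fin N) ℂ) i)
    (ω : SiteY i → ℝ) (Ψ : SiteY i → Matrix (Fin N) (Fin N) ℂ) {z : SiteY i} (hz : z ∉ D) :
    ((ω z : ℝ) : ℂ) • GsqY i par D U Ψ z = 0 := by
  rw [GsqY_apply_eq_zero i par U Ψ hz, smul_zero]

/-- the projection of a field vanishing off `B` vanishes off `B`. [cite: Balaban1985BackgroundPropagators, (3.79) p.406, bookkeeping] -/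
theorem cubeProjY_apply_eq_zero_of_support (D : Finset (SiteY i)) {B : Finset (SiteY i)} {Ψ : SiteY i → Matrix (Fin N) (Fin N) ℂ}
    (hΨ : ∀ z, z ∉ B → Ψ z = 0) {z : SiteY i} (hz : z ∉ B) : cubeProjY i D Ψ z = 0 := by
  rw [cubeProjY_apply]
  split_ifs
  · exact hΨ z hz
  · rfl

/-- `P_D Δ′_a(U) G′_□(U) Ψ = P_D Ψ` at every `G`-valued `U` (regime-free, from the positivity of the padded compression).
[cite: Balaban1985BackgroundPropagators, (3.79) p.406, (3.25) p.395] -/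
theorem cubeProjY_deltaPrimeAY_GsqY_apply (hG : G ≤ B7Prop2Explicit.unitaryUnits (Matrix (Fin N) (Fin N) ℂ))
    {U : CfgY (Matrix (Fin N) (Fin N) ℂ) i} (hU : ∀ μ x, U μ x ∈ G) (D : Finset (SiteY i)) (Ψ : SiteY i → Matrix (Fin N) (Fin N) ℂ) :
    cubeProjY i D (deltaPrimeAY i (parSymY i) U (GsqY i (parSymY i) D U Ψ)) = cubeProjY i D Ψ := by
  have h := cubeProjY_mul_deltaPrimeAY_mul_GsqY i (parSymY i) (isUnit_padDeltaY_parSymY i hG hU D)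
  have h' := congrArg (fun T : Module.End ℂ (SiteY i → Matrix (Fin N) (Fin N) ℂ) => T Ψ) h
  simpa only [Module.End.mul_apply] using h'

/-- the form of `Δ′_a(U)` at `G′_□(U)Ψ` is the pairing with the source: `⟨G′_□Ψ, Δ′_a(U)G′_□Ψ⟩₁ = ⟨G′_□Ψ, Ψ⟩₁` (regime-free; `G′_□Ψ` is □̃-supported and
`P_D Δ′_a G′_□ = P_D`). [cite: Balaban1985BackgroundPropagators, (3.79) p.406, (3.25) p.395] -/
theorem trIP_GsqY_deltaPrimeAY_GsqY (hG : G ≤ B7Prop2Explicit.unitaryUnits (Matrix (Fin N) (Fin N) ℂ))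
    {U : CfgY (Matrix (Fin N) (Fin N) ℂ) i} (hU : ∀ μ x, U μ x ∈ G) (D : Finset (SiteY i)) (Ψ : SiteY i → Matrix (Fin N) (Fin N) ℂ) :
    trIP (fun _ => (1 : ℝ)) (GsqY i (parSymY i) D U Ψ) (deltaPrimeAY i (parSymY i) U (GsqY i (parSymY i) D U Ψ))
      = trIP (fun _ => (1 : ℝ)) (GsqY i (parSymY i) D U Ψ) Ψ := by
  have hfix : cubeProjY i D (GsqY i (parSymY i) D U Ψ) = GsqY i (parSymY i) D U Ψ :=
    cubeProjY_apply_of_support i fun z hz => GsqY_apply_eq_zero i (parSymY i) U Ψ hz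
  calc trIP (fun _ => (1 : ℝ)) (GsqY i (parSymY i) D U Ψ) (deltaPrimeAY i (parSymY i) U (GsqY i (parSymY i) D U Ψ))
      = trIP (fun _ => (1 : ℝ)) (cubeProjY i D (GsqY i (parSymY i) D U Ψ)) (deltaPrimeAY i (parSymY i) U (GsqY i (parSymY i) D U Ψ)) := by rw [hfix]
    _ = trIP (fun _ => (1 : ℝ)) (GsqY i (parSymY i) D U Ψ) (cubeProjY i D Ψ) := by
        rw [← trIP_cubeProjY_symm, cubeProjY_deltaPrimeAY_GsqY_apply i hG hU D Ψ]
    _ = trIP (fun _ => (1 : ℝ)) (GsqY i (parSymY i) D U Ψ) Ψ := by rw [trIP_cubeProjY_symm, hfix]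

end Support

/-! ## §2 Agmon's readings for `G′_□(U)` -/

section Agmon

/-- at `Φ = G′_□(U)Ψ` with `Ψ` supported where `ω = 1`, THE CONJUGATED FORM OF `ωΦ` IS THE PLAIN PAIRING: `⟨ω(ωΦ), Δ′_a(U)(ω⁻¹(ωΦ))⟩₁ = ⟨Φ, Ψ⟩₁`
(`G`-valued `U`, `G ≤ U(N)`; no smallness; every □̃ = `D`). [cite: Agmon1982, Ch.1; Balaban1985BackgroundPropagators, (3.79) p.406, (3.25) p.395] -/
theorem conj_wsmul_GsqY_eq_pairing (hG : G ≤ B7Prop2Explicit.unitaryUnits (Matrix (Fin N) (Fin N) ℂ)) {U : CfgY (Matrix (Fin N) (Fin N) ℂ) i}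
    (hU : ∀ μ x, U μ x ∈ G) (D : Finset (SiteY i)) {ω : SiteY i → ℝ} (hω : ∀ z, 0 < ω z) {B : Finset (SiteY i)}
    {Ψ : SiteY i → Matrix (Fin N) (Fin N) ℂ} (hΨ : ∀ z, z ∉ B → Ψ z = 0) (hωB : ∀ z ∈ B, ω z = 1) :
    trIP (fun _ => (1 : ℝ)) (fun z => ((ω z : ℝ) : ℂ) • (((ω z : ℝ) : ℂ) • GsqY i (parSymY i) D U Ψ z))
        (deltaPrimeAY i (parSymY i) U (fun z => (((ω z)⁻¹ : ℝ) : ℂ) • (((ω z : ℝ) : ℂ) • GsqY i (parSymY i) D U Ψ z)))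
      = trIP (fun _ => (1 : ℝ)) (GsqY i (parSymY i) D U Ψ) Ψ := by
  have hinvΦ : (fun z => (((ω z)⁻¹ : ℝ) : ℂ) • (((ω z : ℝ) : ℂ) • GsqY i (parSymY i) D U Ψ z)) = GsqY i (parSymY i) D U Ψ := by
    funext z
    rw [smul_smul, ← Complex.ofReal_mul, inv_mul_cancel₀ (hω z).ne', Complex.ofReal_one, one_smul]
  -- the doubly weighted copy is supported in □̃, hence fixed by `P_D`
  have hfix : cubeProjY i D (fun z => ((ω z : ℝ) : ℂ) • (((ω z : ℝ) : ℂ) • GsqY i (parSymY i) D U Ψ z))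
      = fun z => ((ω z : ℝ) : ℂ) • (((ω z : ℝ) : ℂ) • GsqY i (parSymY i) D U Ψ z) :=
    cubeProjY_apply_of_support i fun z hz => by rw [wsmul_GsqY_apply_eq_zero i (parSymY i) U ω Ψ hz, smul_zero]
  rw [hinvΦ, ← hfix, ← trIP_cubeProjY_symm, cubeProjY_deltaPrimeAY_GsqY_apply i hG hU D Ψ,
    trIP_wsq_eq_of_support i hωB (fun z hz => cubeProjY_apply_eq_zero_of_support i D hΨ hz),
    trIP_cubeProjY_symm, ← Module.End.mul_apply, cubeProjY_mul_GsqY]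

/-- ★★ **AGMON'S FIRST READING FOR `G′_□(U)`**: on the class, for `Ψ` vanishing off `B`, a weight `ω > 0` with `ω = 1` on `B` meeting the bond∕block hypotheses,
and `Φ := G′_□(U)Ψ`: `(1∕8 − (d+1)θ_b − θ_s∕2)·Σ_z m_z·HS(ω_z·Φ z) ≤ ⟨Φ, Ψ⟩₁`. [cite: Agmon1982, Ch.1, Thm 1.5; Balaban1985BackgroundPropagators, Cor 3.6 p.408, (3.46) p.398, (3.79) p.406] -/
theorem levelMass_wsmul_GsqY_le_pairing [Nonempty (Fin N)] (hG : G ≤ B7Prop2Explicit.unitaryUnits (Matrix (Fin N) (Fin N) ℂ))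
    {U : CfgY (Matrix (Fin N) (Fin N) ℂ) i} {c α₀ : ℝ} (hC0 : 0 ≤ c * (kGeo i).M * α₀) (hC1 : c * (kGeo i).M * α₀ * ((d : ℝ) + 1) ≤ 1 / 16)
    (hreg : (bg9K (Matrix (Fin N) (Fin N) ℂ) G i).Reg335 c α₀ U) (D : Finset (SiteY i)) {ω : SiteY i → ℝ} (hω : ∀ z, 0 < ω z) {θb θs : ℝ}
    (hb1 : ∀ μ z, ω (shiftY i μ z) / ω z + ω z / ω (shiftY i μ z) - 2 ≤ θb * (((((ℓ + 1) ^ (blkOf i.D.toDomains z).1.1 : ℕ) : ℝ)) ^ 2)⁻¹)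
    (hb2 : ∀ μ z, ω (shiftY i μ z) / ω z + ω z / ω (shiftY i μ z) - 2 ≤ θb * (((((ℓ + 1) ^ (blkOf i.D.toDomains (shiftY i μ z)).1.1 : ℕ) : ℝ)) ^ 2)⁻¹)
    (hs : ∀ z w : SiteY i, blkOf i.D.toDomains w = blkOf i.D.toDomains z → ω z / ω w + ω w / ω z - 2 ≤ θs)
    {B : Finset (SiteY i)} {Ψ : SiteY i → Matrix (Fin N) (Fin N) ℂ} (hΨ : ∀ z, z ∉ B → Ψ z = 0) (hωB : ∀ z ∈ B, ω z = 1) :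
    (1 / 8 - (((d : ℝ) + 1) * θb + θs / 2)) *
        ∑ z : SiteY i, (((((ℓ + 1) ^ (blkOf i.D.toDomains z).1.1 : ℕ) : ℝ)) ^ 2)⁻¹ * ∑ a, ∑ b, ‖(((ω z : ℝ) : ℂ) • GsqY i (parSymY i) D U Ψ z) a b‖ ^ 2
      ≤ trIP (fun _ => (1 : ℝ)) (GsqY i (parSymY i) D U Ψ) Ψ := by
  have hconj := trIP_wsmul_deltaPrimeAY_winv_ge_levelMass i hG hC0 hC1 hreg hω hb1 hb2 hs (fun z => ((ω z : ℝ) : ℂ) • GsqY i (parSymY i) D U Ψ z)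
  rwa [conj_wsmul_GsqY_eq_pairing i hG hreg.1 D hω hΨ hωB] at hconj

/-- ★★ **AGMON'S SECOND READING FOR `G′_□(U)`**: `(1∕8 − (d+1)θ_b − θ_s∕2)·(L^{j_B})⁻²·⟨G′_□(U)Ψ, Ψ⟩₁ ≤ ‖Ψ‖²₁` (levels `≤ j_B` on `B`).
[cite: Agmon1982, Ch.1, Thm 1.5; Balaban1985BackgroundPropagators, Cor 3.6 p.408, (3.46) p.398, (3.79) p.406] -/
theorem pairing_GsqY_le_of_support [Nonempty (Fin N)] (hG : G ≤ B7Prop2Explicit.unitaryUnits (Matrix (Fin N) (Fin N) ℂ))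
    {U : CfgY (Matrix (Fin N) (Fin N) ℂ) i} {c α₀ : ℝ} (hC0 : 0 ≤ c * (kGeo i).M * α₀) (hC1 : c * (kGeo i).M * α₀ * ((d : ℝ) + 1) ≤ 1 / 16)
    (hreg : (bg9K (Matrix (Fin N) (Fin N) ℂ) G i).Reg335 c α₀ U) (D : Finset (SiteY i)) {ω : SiteY i → ℝ} (hω : ∀ z, 0 < ω z) {θb θs : ℝ}
    (hb1 : ∀ μ z, ω (shiftY i μ z) / ω z + ω z / ω (shiftY i μ z) - 2 ≤ θb * (((((ℓ + 1) ^ (blkOf i.D.toDomains z).1.1 : ℕ) : ℝ)) ^ 2)⁻¹)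
    (hb2 : ∀ μ z, ω (shiftY i μ z) / ω z + ω z / ω (shiftY i μ z) - 2 ≤ θb * (((((ℓ + 1) ^ (blkOf i.D.toDomains (shiftY i μ z)).1.1 : ℕ) : ℝ)) ^ 2)⁻¹)
    (hs : ∀ z w : SiteY i, blkOf i.D.toDomains w = blkOf i.D.toDomains z → ω z / ω w + ω w / ω z - 2 ≤ θs)
    (hκ : ((d : ℝ) + 1) * θb + θs / 2 ≤ 1 / 16)
    {B : Finset (SiteY i)} {Ψ : SiteY i → Matrix (Fin N) (Fin N) ℂ} (hΨ : ∀ z, z ∉ B → Ψ z = 0) (hωB : ∀ z ∈ B, ω z = 1)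
    {jB : ℕ} (hjB : ∀ z ∈ B, (blkOf i.D.toDomains z).1.1 ≤ jB) :
    (1 / 8 - (((d : ℝ) + 1) * θb + θs / 2)) * (((((ℓ + 1) ^ jB : ℕ) : ℝ)) ^ 2)⁻¹ * trIP (fun _ => (1 : ℝ)) (GsqY i (parSymY i) D U Ψ) Ψ
      ≤ trIP (fun _ => (1 : ℝ)) Ψ Ψ := by
  have hc₀0 : 0 < 1 / 8 - (((d : ℝ) + 1) * θb + θs / 2) := by linarith
  have hiX := levelMass_wsmul_GsqY_le_pairing i hG hC0 hC1 hreg D hω hb1 hb2 hs hΨ hωB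
  have hPB0 : 0 ≤ ∑ z ∈ B, ∑ a, ∑ b, ‖GsqY i (parSymY i) D U Ψ z a b‖ ^ 2 := Finset.sum_nonneg fun _ _ => hs_nonneg _
  have hQ0 : 0 ≤ trIP (fun _ => (1 : ℝ)) Ψ Ψ := trIP_self_nonneg _ (fun _ => one_pos) Ψ
  have hX2 : trIP (fun _ => (1 : ℝ)) (GsqY i (parSymY i) D U Ψ) Ψ ^ 2
      ≤ (∑ z ∈ B, ∑ a, ∑ b, ‖GsqY i (parSymY i) D U Ψ z a b‖ ^ 2) * trIP (fun _ => (1 : ℝ)) Ψ Ψ := by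
    have h := abs_trIP_le_of_support i hΨ (GsqY i (parSymY i) D U Ψ)
    calc trIP (fun _ => (1 : ℝ)) (GsqY i (parSymY i) D U Ψ) Ψ ^ 2 = |trIP (fun _ => (1 : ℝ)) (GsqY i (parSymY i) D U Ψ) Ψ| ^ 2 := (sq_abs _).symm
      _ ≤ (Real.sqrt (∑ z ∈ B, ∑ a, ∑ b, ‖GsqY i (parSymY i) D U Ψ z a b‖ ^ 2) * Real.sqrt (trIP (fun _ => (1 : ℝ)) Ψ Ψ)) ^ 2 :=
          pow_le_pow_left₀ (abs_nonneg _) h 2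
      _ = _ := by rw [mul_pow, Real.sq_sqrt hPB0, Real.sq_sqrt hQ0]
  have hMB := sum_filter_hs_le_levelMass i ω hjB zero_le_one (fun z hz => (hωB z hz).ge) (GsqY i (parSymY i) D U Ψ)
  rw [one_pow, mul_one] at hMB
  exact agmon_arith_pairing hc₀0 (inv_pos.2 (by positivity)) hPB0 hQ0 hiX hX2 hMB

/-- ★★★ **THE `L²`-LOCAL DECAY OF `G′_□(U)` ON THE CLASS (3.35) — COROLLARY 3.6's (3.46a) IN `L²` BY AGMON'S METHOD, UNIFORMLY IN □.**  `G ≤ U(N)`, `N ≥ 1`,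
`0 ≤ c·M·α₀`, `c·M·α₀·(d+1) ≤ 1∕16`, `U ∈ (bg9K (M_N ℂ) G i).Reg335 c α₀`; any site set `D` (□̃); finite site sets `A`, `B`; `Ψ` vanishing off `B`; a weight
`ω > 0` with `ω = 1` on `B`, `ω ≥ W > 0` on `A`, bond ratios `≤ θ_b·(L^{lev})⁻²`, block oscillation `≤ θ_s`, `(d+1)θ_b + θ_s∕2 ≤ 1∕16`; levels `≤ j_A` on `A`,
`≤ j_B` on `B`.  THEN `Σ_{z∈A} HS((G′_□(U)Ψ)(z)) ≤ 256·((L^{j_A})²(L^{j_B})²∕W²)·‖Ψ‖²₁` — the constants of file 6, free of □.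
[cite: Balaban1985BackgroundPropagators, Cor 3.6 p.408 («constants independent of □»), Thm 3.1 (3.46) p.398, (3.79) p.406; Agmon1982, Ch.1, Thm 1.5; CombesThomas1973] -/
theorem hs_restrict_GsqY_parSymY_le [Nonempty (Fin N)] (hG : G ≤ B7Prop2Explicit.unitaryUnits (Matrix (Fin N) (Fin N) ℂ))
    {U : CfgY (Matrix (Fin N) (Fin N) ℂ) i} {c α₀ : ℝ} (hC0 : 0 ≤ c * (kGeo i).M * α₀) (hC1 : c * (kGeo i).M * α₀ * ((d : ℝ) + 1) ≤ 1 / 16)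
    (hreg : (bg9K (Matrix (Fin N) (Fin N) ℂ) G i).Reg335 c α₀ U) (D : Finset (SiteY i)) {ω : SiteY i → ℝ} (hω : ∀ z, 0 < ω z) {θb θs : ℝ}
    (hb1 : ∀ μ z, ω (shiftY i μ z) / ω z + ω z / ω (shiftY i μ z) - 2 ≤ θb * (((((ℓ + 1) ^ (blkOf i.D.toDomains z).1.1 : ℕ) : ℝ)) ^ 2)⁻¹)
    (hb2 : ∀ μ z, ω (shiftY i μ z) / ω z + ω z / ω (shiftY i μ z) - 2 ≤ θb * (((((ℓ + 1) ^ (blkOf i.D.toDomains (shiftY i μ z)).1.1 : ℕ) : ℝ)) ^ 2)⁻¹)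
    (hs : ∀ z w : SiteY i, blkOf i.D.toDomains w = blkOf i.D.toDomains z → ω z / ω w + ω w / ω z - 2 ≤ θs)
    (hκ : ((d : ℝ) + 1) * θb + θs / 2 ≤ 1 / 16)
    {A B : Finset (SiteY i)} {Ψ : SiteY i → Matrix (Fin N) (Fin N) ℂ} (hΨ : ∀ z, z ∉ B → Ψ z = 0) (hωB : ∀ z ∈ B, ω z = 1)
    {jA jB : ℕ} (hjA : ∀ z ∈ A, (blkOf i.D.toDomains z).1.1 ≤ jA) (hjB : ∀ z ∈ B, (blkOf i.D.toDomains z).1.1 ≤ jB)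
    {W : ℝ} (hW0 : 0 < W) (hW : ∀ z ∈ A, W ≤ ω z) :
    ∑ z ∈ A, ∑ a, ∑ b, ‖GsqY i (parSymY i) D U Ψ z a b‖ ^ 2
      ≤ 256 * (((((ℓ + 1) ^ jA : ℕ) : ℝ)) ^ 2 * ((((ℓ + 1) ^ jB : ℕ) : ℝ)) ^ 2 / W ^ 2) * trIP (fun _ => (1 : ℝ)) Ψ Ψ := by
  have hc₀pos : 1 / 16 ≤ 1 / 8 - (((d : ℝ) + 1) * θb + θs / 2) := by linarith
  have hc₀0 : 0 < 1 / 8 - (((d : ℝ) + 1) * θb + θs / 2) := lt_of_lt_of_le (by norm_num) hc₀pos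
  have hiX := levelMass_wsmul_GsqY_le_pairing i hG hC0 hC1 hreg D hω hb1 hb2 hs hΨ hωB
  have hPB0 : 0 ≤ ∑ z ∈ B, ∑ a, ∑ b, ‖GsqY i (parSymY i) D U Ψ z a b‖ ^ 2 := Finset.sum_nonneg fun _ _ => hs_nonneg _
  have hQ0 : 0 ≤ trIP (fun _ => (1 : ℝ)) Ψ Ψ := trIP_self_nonneg _ (fun _ => one_pos) Ψ
  have hX2 : trIP (fun _ => (1 : ℝ)) (GsqY i (parSymY i) D U Ψ) Ψ ^ 2
      ≤ (∑ z ∈ B, ∑ a, ∑ b, ‖GsqY i (parSymY i) D U Ψ z a b‖ ^ 2) * trIP (fun _ => (1 : ℝ)) Ψ Ψ := by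
    have h := abs_trIP_le_of_support i hΨ (GsqY i (parSymY i) D U Ψ)
    calc trIP (fun _ => (1 : ℝ)) (GsqY i (parSymY i) D U Ψ) Ψ ^ 2 = |trIP (fun _ => (1 : ℝ)) (GsqY i (parSymY i) D U Ψ) Ψ| ^ 2 := (sq_abs _).symm
      _ ≤ (Real.sqrt (∑ z ∈ B, ∑ a, ∑ b, ‖GsqY i (parSymY i) D U Ψ z a b‖ ^ 2) * Real.sqrt (trIP (fun _ => (1 : ℝ)) Ψ Ψ)) ^ 2 :=
          pow_le_pow_left₀ (abs_nonneg _) h 2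
      _ = _ := by rw [mul_pow, Real.sq_sqrt hPB0, Real.sq_sqrt hQ0]
  have hMB := sum_filter_hs_le_levelMass i ω hjB zero_le_one (fun z hz => (hωB z hz).ge) (GsqY i (parSymY i) D U Ψ)
  rw [one_pow, mul_one] at hMB
  have hMA := sum_filter_hs_le_levelMass i ω hjA hW0.le hW (GsqY i (parSymY i) D U Ψ)
  have hfin := agmon_arith hc₀0 (inv_pos.2 (by positivity)) hPB0 hQ0 hiX hX2 hMB hMA
  exact agmon_unpack hc₀pos (by positivity) (by positivity) hW0 hQ0 hfin

end Agmon

/-! ## §3 The exponential weight and print's rate in the block distance -/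

section Rates

/-- ★★★ **(3.46a) FOR `G′_□(U)` WITH THE AGMON WEIGHT `e^{δρ}`** (file 7's hypotheses on `δ, D_osc, ρ`), uniformly in □:
`Σ_{z∈A} HS((G′_□(U)λ)(z)) ≤ 256·((L^{j_A})²(L^{j_B})²∕(e^{δr})²)·‖λ‖²₁`. [cite: Balaban1985BackgroundPropagators, Cor 3.6 p.408, Thm 3.1 (3.46) p.398, (3.79) p.406; Agmon1982, Ch.1, Thm 1.5; CombesThomas1973] -/
theorem hs_restrict_GsqY_parSymY_le_exp [Nonempty (Fin N)] (hG : G ≤ B7Prop2Explicit.unitaryUnits (Matrix (Fin N) (Fin N) ℂ))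
    {U : CfgY (Matrix (Fin N) (Fin N) ℂ) i} {c α₀ : ℝ} (hC0 : 0 ≤ c * (kGeo i).M * α₀) (hC1 : c * (kGeo i).M * α₀ * ((d : ℝ) + 1) ≤ 1 / 16)
    (hreg : (bg9K (Matrix (Fin N) (Fin N) ℂ) G i).Reg335 c α₀ U) (D : Finset (SiteY i)) {δ Dosc : ℝ} (hδ0 : 0 ≤ δ) (hδ1 : δ ≤ 1) (hδD : δ * Dosc ≤ 1)
    (hδκ : δ ^ 2 * (2 * ((d : ℝ) + 1) + Dosc ^ 2) ≤ 1 / 16) {ρ : SiteY i → ℝ}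
    (hρ1 : ∀ μ z, |ρ (shiftY i μ z) - ρ z| ≤ ((((ℓ + 1) ^ (blkOf i.D.toDomains z).1.1 : ℕ) : ℝ))⁻¹)
    (hρ2 : ∀ μ z, |ρ (shiftY i μ z) - ρ z| ≤ ((((ℓ + 1) ^ (blkOf i.D.toDomains (shiftY i μ z)).1.1 : ℕ) : ℝ))⁻¹)
    (hρD : ∀ z w : SiteY i, blkOf i.D.toDomains w = blkOf i.D.toDomains z → |ρ z - ρ w| ≤ Dosc)
    {A B : Finset (SiteY i)} {Ψ : SiteY i → Matrix (Fin N) (Fin N) ℂ} (hΨ : ∀ z, z ∉ B → Ψ z = 0) (hρB : ∀ z ∈ B, ρ z = 0)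
    {jA jB : ℕ} (hjA : ∀ z ∈ A, (blkOf i.D.toDomains z).1.1 ≤ jA) (hjB : ∀ z ∈ B, (blkOf i.D.toDomains z).1.1 ≤ jB)
    {r : ℝ} (hr : ∀ z ∈ A, r ≤ ρ z) :
    ∑ z ∈ A, ∑ a, ∑ b, ‖GsqY i (parSymY i) D U Ψ z a b‖ ^ 2
      ≤ 256 * (((((ℓ + 1) ^ jA : ℕ) : ℝ)) ^ 2 * ((((ℓ + 1) ^ jB : ℕ) : ℝ)) ^ 2 / Real.exp (δ * r) ^ 2) * trIP (fun _ => (1 : ℝ)) Ψ Ψ := by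
  have hω : ∀ z, 0 < Real.exp (δ * ρ z) := fun z => Real.exp_pos _
  have hκ : ((d : ℝ) + 1) * (2 * δ ^ 2) + (2 * δ ^ 2 * Dosc ^ 2) / 2 ≤ 1 / 16 := by nlinarith
  have hωB : ∀ z ∈ B, Real.exp (δ * ρ z) = 1 := fun z hz => by rw [hρB z hz, mul_zero, Real.exp_zero]
  have hW : ∀ z ∈ A, Real.exp (δ * r) ≤ Real.exp (δ * ρ z) := fun z hz => Real.exp_le_exp.2 (mul_le_mul_of_nonneg_left (hr z hz) hδ0)
  exact hs_restrict_GsqY_parSymY_le i hG hC0 hC1 hreg D hω (fun μ z => bondRatio_exp_le i hδ0 hδ1 μ z (hρ1 μ z))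
    (fun μ z => bondRatio_exp_le' i hδ0 hδ1 μ z (hρ2 μ z)) (fun z w hzw => blockOsc_exp_le i hδ0 hδD z w (hρD z w hzw)) hκ hΨ hωB hjA hjB
    (Real.exp_pos _) hW

/-- ★★★ **THE CANONICAL RATE FOR `G′_□(U)`**: `D_osc = d+1`, `δ₀ := 1∕(4(d+2))`: `Σ_{z∈A} HS((G′_□(U)λ)(z)) ≤ 256·((L^{j_A})²(L^{j_B})²∕(e^{δ₀r})²)·‖λ‖²₁` — `B₀ = 16`,
`δ₀ = 1∕(4(d+2))`, free of the member, the volume, `k`, `N`, `U` and □. [cite: Balaban1985BackgroundPropagators, Cor 3.6 p.408, Thm 3.1 (3.46) p.398; Agmon1982, Ch.1, Thm 1.5] -/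
theorem hs_restrict_GsqY_parSymY_le_exp_canonical [Nonempty (Fin N)] (hG : G ≤ B7Prop2Explicit.unitaryUnits (Matrix (Fin N) (Fin N) ℂ))
    {U : CfgY (Matrix (Fin N) (Fin N) ℂ) i} {c α₀ : ℝ} (hC0 : 0 ≤ c * (kGeo i).M * α₀) (hC1 : c * (kGeo i).M * α₀ * ((d : ℝ) + 1) ≤ 1 / 16)
    (hreg : (bg9K (Matrix (Fin N) (Fin N) ℂ) G i).Reg335 c α₀ U) (D : Finset (SiteY i)) {ρ : SiteY i → ℝ}
    (hρ1 : ∀ μ z, |ρ (shiftY i μ z) - ρ z| ≤ ((((ℓ + 1) ^ (blkOf i.D.toDomains z).1.1 : ℕ) : ℝ))⁻¹)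
    (hρ2 : ∀ μ z, |ρ (shiftY i μ z) - ρ z| ≤ ((((ℓ + 1) ^ (blkOf i.D.toDomains (shiftY i μ z)).1.1 : ℕ) : ℝ))⁻¹)
    (hρD : ∀ z w : SiteY i, blkOf i.D.toDomains w = blkOf i.D.toDomains z → |ρ z - ρ w| ≤ (d : ℝ) + 1)
    {A B : Finset (SiteY i)} {Ψ : SiteY i → Matrix (Fin N) (Fin N) ℂ} (hΨ : ∀ z, z ∉ B → Ψ z = 0) (hρB : ∀ z ∈ B, ρ z = 0)
    {jA jB : ℕ} (hjA : ∀ z ∈ A, (blkOf i.D.toDomains z).1.1 ≤ jA) (hjB : ∀ z ∈ B, (blkOf i.D.toDomains z).1.1 ≤ jB)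
    {r : ℝ} (hr : ∀ z ∈ A, r ≤ ρ z) :
    ∑ z ∈ A, ∑ a, ∑ b, ‖GsqY i (parSymY i) D U Ψ z a b‖ ^ 2
      ≤ 256 * (((((ℓ + 1) ^ jA : ℕ) : ℝ)) ^ 2 * ((((ℓ + 1) ^ jB : ℕ) : ℝ)) ^ 2 / Real.exp ((1 / (4 * ((d : ℝ) + 2))) * r) ^ 2)
          * trIP (fun _ => (1 : ℝ)) Ψ Ψ := by
  have hd0 : (0 : ℝ) ≤ d := Nat.cast_nonneg d
  have hd2 : (0 : ℝ) < 4 * ((d : ℝ) + 2) := by positivity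
  have hδ0 : (0 : ℝ) ≤ 1 / (4 * ((d : ℝ) + 2)) := by positivity
  have hδ1 : 1 / (4 * ((d : ℝ) + 2)) ≤ 1 := by rw [div_le_one hd2]; linarith
  have hδD : 1 / (4 * ((d : ℝ) + 2)) * ((d : ℝ) + 1) ≤ 1 := by
    rw [div_mul_eq_mul_div, one_mul, div_le_one hd2]; linarith
  have hδκ : (1 / (4 * ((d : ℝ) + 2))) ^ 2 * (2 * ((d : ℝ) + 1) + ((d : ℝ) + 1) ^ 2) ≤ 1 / 16 := by
    rw [div_pow, one_pow, mul_pow, one_div_mul_eq_div, div_le_iff₀ (by positivity)]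
    nlinarith
  exact hs_restrict_GsqY_parSymY_le_exp i hG hC0 hC1 hreg D hδ0 hδ1 hδD hδκ hρ1 hρ2 hρD hΨ hρB hjA hjB hr

/-- ★★★ **(3.46a) FOR `G′_□(U)` WITH PRINT'S RATE IN THE BLOCK DISTANCE** (dag-n06-j's multi-scale exponent `msRhoT`): a source block `s`, `λ` carried by
sites `B` of `s`, `A` in blocks at block distance `≥ n` from `s`, levels `≤ j_A` on `A`, `≤ j_B` on `B`:
`Σ_{z∈A}HS((G′_□(U)λ)(z)) ≤ 256·((L^{j_A})²(L^{j_B})²∕(e^{δ₀(n−1)∕(2L)})²)·‖λ‖²₁`, `δ₀ = 1∕(4(d+2))` — uniformly in the member, the volume, `k`, `N`, `U`, □.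
[cite: Balaban1985BackgroundPropagators, Cor 3.6 p.408, Thm 3.1 (3.46) p.398, p.397 (weighted distance); Balaban1984PropagatorsII, (2.46) p.231; Agmon1982, Ch.1, Thm 1.5] -/
theorem hs_restrict_GsqY_parSymY_le_distT [Nonempty (Fin N)] (hG : G ≤ B7Prop2Explicit.unitaryUnits (Matrix (Fin N) (Fin N) ℂ))
    {U : CfgY (Matrix (Fin N) (Fin N) ℂ) i} {c α₀ : ℝ} (hC0 : 0 ≤ c * (kGeo i).M * α₀) (hC1 : c * (kGeo i).M * α₀ * ((d : ℝ) + 1) ≤ 1 / 16)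
    (hreg : (bg9K (Matrix (Fin N) (Fin N) ℂ) G i).Reg335 c α₀ U) (D : Finset (SiteY i)) (s : BlkY i)
    {A B : Finset (SiteY i)} {Ψ : SiteY i → Matrix (Fin N) (Fin N) ℂ} (hΨ : ∀ z, z ∉ B → Ψ z = 0)
    (hB : ∀ z ∈ B, blkOf i.D.toDomains z = s) {n : ℕ} (hA : ∀ z ∈ A, n ≤ (bondT i.D).dist (blkOf i.D.toDomains z) s)
    {jA jB : ℕ} (hjA : ∀ z ∈ A, (blkOf i.D.toDomains z).1.1 ≤ jA) (hjB : ∀ z ∈ B, (blkOf i.D.toDomains z).1.1 ≤ jB) :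
    ∑ z ∈ A, ∑ a, ∑ b, ‖GsqY i (parSymY i) D U Ψ z a b‖ ^ 2
      ≤ 256 * (((((ℓ + 1) ^ jA : ℕ) : ℝ)) ^ 2 * ((((ℓ + 1) ^ jB : ℕ) : ℝ)) ^ 2
            / Real.exp ((1 / (4 * ((d : ℝ) + 2))) * ((((n : ℝ)) - 1) / (2 * ((ℓ + 1 : ℕ) : ℝ)))) ^ 2)
          * trIP (fun _ => (1 : ℝ)) Ψ Ψ :=
  hs_restrict_GsqY_parSymY_le_exp_canonical i hG hC0 hC1 hreg D (ρ := msRhoT i.D s) (msRhoY_bond i s) (msRhoY_bond' i s)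
    (msRhoY_block i s) hΨ (fun z hz => msRhoY_eq_zero i (hB z hz)) hjA hjB (msRhoY_ge_of_le i s hA)

/-- ★ **THE WHOLE-LATTICE FACE**: at `D = univ` these are files 6∕7∕`B9Thm31SiteAgmonExponentY` for `G′(U) = GpY` (def-Y's `GsqY_univ`).
[cite: Balaban1985BackgroundPropagators, (3.25) p.395, (3.79) p.406, bookkeeping] -/
theorem hs_restrict_GsqY_univ_eq (U : CfgY (Matrix (Fin N) (Fin N) ℂ) i) (Ψ : SiteY i → Matrix (Fin N) (Fin N) ℂ) (A : Finset (SiteY i)) :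
    ∑ z ∈ A, ∑ a, ∑ b, ‖GsqY i (parSymY i) Finset.univ U Ψ z a b‖ ^ 2 = ∑ z ∈ A, ∑ a, ∑ b, ‖GpY i (parSymY i) U Ψ z a b‖ ^ 2 := by
  rw [GsqY_univ]

end Rates

end Literature.MathematicalPhysics.QuantumFieldTheory.Balaban1983to89.B9Thm31SiteGsqDecayReg335Y
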